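import Literature.NumberTheory.LFunctions.RobinCriterionTFree
import Literature.NumberTheory.LFunctions.RobinTFreeMertens
import Literature.NumberTheory.LFunctions.RobinBriggsRange
import Literature.NumberTheory.LFunctions.RosserSchoenfeldEq321FromDusart
import HarnessLib

/-!
# RH-FREE — Robin's inequality for `7`-free (hence `5`-free) integers from Dusart's `θ` bound (Solé–Planat 2012; CLMS 2007, Thm. 1.5; Broughan vol. 1, §§8.3–8.4)

RH-FREE (unconditional theorems, modulo the named fact `Dusart2010_theta_thm_5_2`); nothing here
bears on the truth of RH. Literature-typing tranche 1 (Broughan, *Equivalents of the Riemann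
Hypothesis* vol. 1, §8.3 "Integers not divisible by the fifth power of any prime" (CLMS 2007,
Thm. 1.5) and §8.4 "… the seventh power" (Solé–Planat 2012)).

Both results are instances of one method (Solé–Planat 2012, §2–3; Broughan–Trudgian 2015; Morrill–Platt
2021; Axler 2023): for `t`-free `n`, `σ(n)/n ≤ Ψ_t(n)/n ≤ ∏_{p ≤ q} (1 − p^{−t})/(1 − p^{−1})` with
`q# ≤ n` (tree: `robinInequality_of_tFree_of_primorial_bound`, `RobinTFreeReduction.lean`), and the
right side is `< e^γ log θ(q) ≤ e^γ log log n` for `q` large by Mertens' theorem with an explicit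
remainder (tree: `RobinTFree.prod_one_sub_inv_inv_le`, Rosser–Schoenfeld (4.20),
`RobinTFreeMertens.lean`) and an explicit bound for `|θ(x) − x|`. Here we take **Dusart's**
`|θ(x) − x| < 0.2 x/log² x` (`x ≥ 3 594 641`; the tree's named fact `Dusart2010_theta_thm_5_2`) as the
`θ`-input and the tree's kernel-certified Robin range `5041 ≤ n ≤ 10^1958000`
(`robinInequality_le_ten_pow_1958000`) for `n < 3594641#`, and PROVE:

* `mertensRemainder_le_of_dusart` : for `x ≥ 3594641`, Rosser–Schoenfeld's remainder satisfies
  `E(x) ≤ 0.2/log³ x + 0.2 (1/(3 log³ x) + 1/(2 log² x))` (with the integrability it presupposes);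
* `prod_dedekindFactor_seven_lt_of_dusart` : for every prime `q ≥ 3594641`,
  `∏_{p ≤ q} (1 + 1/p + ⋯ + 1/p⁶) < e^γ log θ(q)` (the Euler factor `∏_{p ≤ 23}(1 − p^{−7}) ≤ 0.99173`
  does duty for `1/ζ(7)`);
* **`robinInequality_of_tFree_seven_of_dusart`** (Solé–Planat 2012, main theorem: "If `N` is `7`-free
  then `σ(N) < e^γ N log log N`", `N > 5040`) and, by monotonicity of `t`-freeness,
  **`CLMS2007_thm1_5_of_dusart : Dusart2010_theta_thm_5_2 → CLMS2007_thm1_5`** (every `5`-free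
  `n > 5040` satisfies Robin's inequality);
* the criteria of Broughan §§8.3–8.4 from Dusart's fact alone: RH `⟺` Robin's inequality for all
  `n ≥ 1` divisible by a fifth (resp. seventh) prime power
  (`riemannHypothesis_iff_robin_of_prime_pow_five_dvd_of_dusart`,
  `riemannHypothesis_iff_robin_of_prime_pow_seven_dvd_of_dusart`; via `robin_iff_holds`, computational
  closure), and the RH-free "a counterexample `> 5040` is divisible by some `p⁷`".

The printed proofs use sharper inputs (CLMS: `P(n) < log n` for the least `t`-free violator and a
MAPLE enumeration; Solé–Planat: Rosser–Schoenfeld's (3.30) and `p_n ≥ 20000`); the route here is the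
one of Morrill–Platt / Axler with Dusart's `k = 2` bound, which reaches `t = 7` but not `t = 11`.

## References

* P. Solé, M. Planat, *The Robin inequality for 7-free integers*, Integers 12 (2012), A65, §3
  (Thm. "If N is 7-free …", Prop. 2, Lemmas) [corpus:paper:arxiv-1012.0671 p0005]. [SolePlanat2012]
* Y. Choie, N. Lichiardopol, P. Moree, P. Solé, J. Théor. Nombres Bordeaux 19 (2007), 357–372,
  Thms 1.5–1.6, §6. [CLMS2007]
* P. Dusart, *Estimates of some functions over primes without R.H.*, arXiv:1002.0442 (2010),
  Thm. 5.2. [Dusart2010]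
* J. B. Rosser, L. Schoenfeld, Illinois J. Math. 6 (1962), 64–94, (4.20). [RosserSchoenfeld1962]
* K. Broughan, *Equivalents of the Riemann Hypothesis. Vol. 1*, CUP 2017, §8.3 (pp. 208–211),
  §8.4 (pp. 211–214). [Broughan2017Arithmetic]
-/

noncomputable section

open Real Filter Topology Set MeasureTheory Finset
open scoped Chebyshev ArithmeticFunction.sigma

namespace Literature.NumberTheory.LFunctions

namespace RobinTFreeDusart

open RobinTFree Mertens

/-! ### The local factor as an Euler factor times a Mertens factor -/

/-- `1 + 1/p + ⋯ + 1/p^{t−1} = (1 − p^{−t}) (1 − 1/p)⁻¹` (`p ≥ 2`). [cite: SolePlanat2012, §1 (Ψ_t)] -/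
theorem dedekindFactor_eq {t p : ℕ} (hp : 2 ≤ p) :
    dedekindFactor t p = (1 - ((p : ℝ)⁻¹) ^ t) * (1 - (p : ℝ)⁻¹)⁻¹ := by
  have hpR : (2 : ℝ) ≤ p := by exact_mod_cast hp
  have hx1 : (p : ℝ)⁻¹ ≠ 1 := by
    have : (p : ℝ)⁻¹ ≤ 1 / 2 := by rw [inv_eq_one_div]; exact one_div_le_one_div_of_le (by norm_num) hpR
    linarith
  rw [dedekindFactor, geom_sum_eq hx1, ← neg_sub (1 : ℝ) ((p : ℝ)⁻¹ ^ t), ← neg_sub (1 : ℝ) (p : ℝ)⁻¹,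
    neg_div_neg_eq, div_eq_mul_inv]

/-- `∏_{p ≤ q} (1 + ⋯ + p^{1−t}) = (∏_{p ≤ q} (1 − p^{−t})) · ∏_{p ≤ q} (1 − 1/p)⁻¹`.
[cite: SolePlanat2012, §3 (proof of Prop. 2)] -/
theorem prod_dedekindFactor_eq (t q : ℕ) :
    ∏ p ∈ Nat.primesLE q, dedekindFactor t p =
      (∏ p ∈ Nat.primesLE q, (1 - ((p : ℝ)⁻¹) ^ t)) * ∏ p ∈ Nat.primesLE q, (1 - (p : ℝ)⁻¹)⁻¹ := by
  rw [← Finset.prod_mul_distrib]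
  exact Finset.prod_congr rfl fun p hp => dedekindFactor_eq (Nat.prime_of_mem_primesLE hp).two_le

/-! ### The Euler factor `∏_{p ≤ q} (1 − p^{−7}) ≤ 0.99173` -/

/-- Each Euler factor lies in `[0, 1]`. [folklore] -/
private theorem euler_factor_mem {t p : ℕ} (hp : 2 ≤ p) :
    0 ≤ 1 - ((p : ℝ)⁻¹) ^ t ∧ 1 - ((p : ℝ)⁻¹) ^ t ≤ 1 := by
  have hpR : (2 : ℝ) ≤ p := by exact_mod_cast hp
  have h0 : 0 ≤ (p : ℝ)⁻¹ := by positivity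
  have h1 : (p : ℝ)⁻¹ ≤ 1 := by
    rw [inv_eq_one_div]; exact (div_le_one (by linarith)).2 (by linarith)
  exact ⟨sub_nonneg.2 (pow_le_one₀ h0 h1), sub_le_self _ (pow_nonneg h0 _)⟩

/-- The partial Euler product only decreases with `q`: for `23 ≤ q`,
`∏_{p ≤ q} (1 − p^{−t}) ≤ ∏_{p ≤ 23} (1 − p^{−t})`. [folklore] -/
private theorem prod_euler_le_prod_23 (t : ℕ) {q : ℕ} (hq : 23 ≤ q) :
    ∏ p ∈ Nat.primesLE q, (1 - ((p : ℝ)⁻¹) ^ t) ≤ ∏ p ∈ Nat.primesLE 23, (1 - ((p : ℝ)⁻¹) ^ t) := by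
  have hsub : Nat.primesLE 23 ⊆ Nat.primesLE q := by
    intro p hp
    rw [Nat.mem_primesLE] at hp ⊢
    exact ⟨hp.1.trans hq, hp.2⟩
  rw [← Finset.prod_sdiff hsub]
  have h1 : ∏ p ∈ Nat.primesLE q \ Nat.primesLE 23, (1 - ((p : ℝ)⁻¹) ^ t) ≤ 1 :=
    Finset.prod_le_one (fun p hp => (euler_factor_mem (Nat.prime_of_mem_primesLE (Finset.sdiff_subset hp)).two_le).1)
      (fun p hp => (euler_factor_mem (Nat.prime_of_mem_primesLE (Finset.sdiff_subset hp)).two_le).2)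
  have h2 : 0 ≤ ∏ p ∈ Nat.primesLE 23, (1 - ((p : ℝ)⁻¹) ^ t) :=
    Finset.prod_nonneg fun p hp => (euler_factor_mem (Nat.prime_of_mem_primesLE hp).two_le).1
  nlinarith

/-- `∏_{p ≤ q} (1 − p^{−7}) ≤ 0.99173` for `q ≥ 23` (`1/ζ(7) = 0.991664…`; Solé–Planat's factor
`1/ζ(t)` in `R_t(N_n) ≈ e^γ/ζ(t)`). [cite: SolePlanat2012, §3 (Prop. 1: lim R_t(N_n) = e^γ/ζ(t))] -/
theorem prod_euler_seven_le {q : ℕ} (hq : 23 ≤ q) :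
    ∏ p ∈ Nat.primesLE q, (1 - ((p : ℝ)⁻¹) ^ 7) ≤ 0.99173 := by
  refine (prod_euler_le_prod_23 7 hq).trans ?_
  have hset : Nat.primesLE 23 = {2, 3, 5, 7, 11, 13, 17, 19, 23} := by decide
  rw [hset]
  norm_num [Finset.prod_insert]

/-! ### The remainder integral under Dusart's bound -/

/-- `θ` is measurable (it factors through `⌊·⌋₊`). [folklore] -/
private theorem measurable_theta : Measurable (fun x : ℝ => θ x) := by
  have : (fun x : ℝ => θ x) = (fun n : ℕ => θ (n : ℝ)) ∘ Nat.floor := by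
    funext x; simp [Chebyshev.theta_eq_theta_coe_floor x]
  rw [this]
  exact (measurable_from_nat (f := fun n : ℕ => θ (n : ℝ))).comp Nat.measurable_floor

/-- The primitive `G(t) = −(1/3)(log t)⁻³ − (1/2)(log t)⁻²` of the majorant
`g(t) = (1 + log t)/(t log⁴ t)`: `G' = g` on `(1, ∞)`. [folklore] -/
private theorem hasDerivAt_G {t : ℝ} (ht : 1 < t) :
    HasDerivAt (fun s : ℝ => -(1 / 3) * (Real.log s ^ 3)⁻¹ - 1 / 2 * (Real.log s ^ 2)⁻¹)
      ((1 + Real.log t) / (t * Real.log t ^ 4)) t := by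
  have ht0 : t ≠ 0 := by linarith
  have hl : 0 < Real.log t := Real.log_pos ht
  have hlog : HasDerivAt Real.log t⁻¹ t := Real.hasDerivAt_log ht0
  have h3 := ((hlog.fun_pow 3).fun_inv (by positivity)).const_mul (-(1 / 3) : ℝ)
  have h2 := ((hlog.fun_pow 2).fun_inv (by positivity)).const_mul (1 / 2 : ℝ)
  have h := h3.sub h2
  refine h.congr_deriv ?_
  have hl0 : Real.log t ≠ 0 := hl.ne'
  norm_num
  field_simp
  ring

/-- `∫_x^∞ (1 + log t)/(t log⁴ t) dt = 1/(3 log³ x) + 1/(2 log² x)` and integrability (`x > 1`).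
[folklore] -/
private theorem integral_g {x : ℝ} (hx : 1 < x) :
    IntegrableOn (fun t : ℝ => (1 + Real.log t) / (t * Real.log t ^ 4)) (Ioi x) ∧
      ∫ t in Ioi x, (1 + Real.log t) / (t * Real.log t ^ 4) =
        1 / (3 * Real.log x ^ 3) + 1 / (2 * Real.log x ^ 2) := by
  have hlx : 0 < Real.log x := Real.log_pos hx
  have hcont : ContinuousWithinAt
      (fun s : ℝ => -(1 / 3) * (Real.log s ^ 3)⁻¹ - 1 / 2 * (Real.log s ^ 2)⁻¹) (Ici x) x :=
    (hasDerivAt_G hx).continuousAt.continuousWithinAt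
  have hderiv : ∀ t ∈ Ioi x, HasDerivAt
      (fun s : ℝ => -(1 / 3) * (Real.log s ^ 3)⁻¹ - 1 / 2 * (Real.log s ^ 2)⁻¹)
      ((1 + Real.log t) / (t * Real.log t ^ 4)) t := fun t ht => hasDerivAt_G (hx.trans ht)
  have hpos : ∀ t ∈ Ioi x, 0 ≤ (1 + Real.log t) / (t * Real.log t ^ 4) := by
    intro t ht
    have : 0 < Real.log t := Real.log_pos (hx.trans ht)
    have : 0 < t := by linarith [hx.trans ht]
    positivity
  have hl := Real.tendsto_log_atTop
  have h3 : Tendsto (fun s : ℝ => (Real.log s ^ 3)⁻¹) atTop (𝓝 0) :=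
    ((tendsto_pow_atTop (by norm_num : (3 : ℕ) ≠ 0)).comp hl).inv_tendsto_atTop
  have h2 : Tendsto (fun s : ℝ => (Real.log s ^ 2)⁻¹) atTop (𝓝 0) :=
    ((tendsto_pow_atTop (by norm_num : (2 : ℕ) ≠ 0)).comp hl).inv_tendsto_atTop
  have hlim : Tendsto (fun s : ℝ => -(1 / 3) * (Real.log s ^ 3)⁻¹ - 1 / 2 * (Real.log s ^ 2)⁻¹)
      atTop (𝓝 (-(1 / 3) * 0 - 1 / 2 * 0)) := (h3.const_mul _).sub (h2.const_mul _)
  have hint := integrableOn_Ioi_deriv_of_nonneg hcont hderiv hpos hlim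
  refine ⟨hint, ?_⟩
  rw [integral_Ioi_of_hasDerivAt_of_tendsto hcont hderiv hint hlim]
  field_simp
  ring

/-- **Rosser–Schoenfeld's remainder under Dusart's bound**: for `x ≥ 3594641`,
`(θ − id)·w` is integrable on `(x, ∞)` and
`E(x) ≤ 0.2/log³ x + 0.2 (1/(3 log³ x) + 1/(2 log² x))`.
[cite: RosserSchoenfeld1962, (4.20); Dusart2010, Thm. 5.2] -/
theorem mertensRemainder_le_of_dusart (hD : Dusart2010_theta_thm_5_2) {x : ℝ} (hx : 3594641 ≤ x) :
    IntegrableOn (fun t => (θ t - t) * mertensWeight t) (Ioi x) ∧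
      mertensRemainder x ≤ 0.2 / Real.log x ^ 3 +
        0.2 * (1 / (3 * Real.log x ^ 3) + 1 / (2 * Real.log x ^ 2)) := by
  have hx1 : 1 < x := by linarith
  have hx0 : 0 < x := by linarith
  have hlx : 0 < Real.log x := Real.log_pos hx1
  obtain ⟨hgi, hgv⟩ := integral_g hx1
  -- pointwise domination `|(θ t − t) w(t)| ≤ 0.2 g(t)` on `(x, ∞)`
  have hdom : ∀ t ∈ Ioi x, ‖(θ t - t) * mertensWeight t‖ ≤ 0.2 * ((1 + Real.log t) / (t * Real.log t ^ 4)) := by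
    intro t ht
    have ht1 : 1 < t := hx1.trans ht
    have ht0 : 0 < t := by linarith
    have hlt : 0 < Real.log t := Real.log_pos ht1
    have hθ := hD t (hx.trans ht.le)
    have hw0 : 0 ≤ mertensWeight t := by unfold mertensWeight; positivity
    rw [Real.norm_eq_abs, abs_mul, abs_of_nonneg hw0]
    calc |θ t - t| * mertensWeight t ≤ (0.2 * t / Real.log t ^ 2) * mertensWeight t :=
          mul_le_mul_of_nonneg_right hθ.le hw0
      _ = 0.2 * ((1 + Real.log t) / (t * Real.log t ^ 4)) := by
          unfold mertensWeight; field_simp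
  have hmeas : AEStronglyMeasurable (fun t => (θ t - t) * mertensWeight t) (volume.restrict (Ioi x)) := by
    refine ((measurable_theta.sub measurable_id).aestronglyMeasurable).mul ?_
    refine (ContinuousOn.aestronglyMeasurable ?_ measurableSet_Ioi)
    unfold mertensWeight
    refine ContinuousOn.div ?_ ?_ ?_
    · exact continuousOn_const.add (Real.continuousOn_log.mono fun t ht => by
        exact ne_of_gt (hx0.trans ht))
    · refine (continuousOn_id.pow 2).mul ((Real.continuousOn_log.mono fun t ht => ?_).pow 2)
      exact ne_of_gt (hx0.trans ht)
    · intro t ht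
      have : 0 < Real.log t := Real.log_pos (hx1.trans ht)
      have : 0 < t := hx0.trans ht
      positivity
  have hint : IntegrableOn (fun t => (θ t - t) * mertensWeight t) (Ioi x) :=
    Integrable.mono' (hgi.const_mul 0.2) hmeas
      ((ae_restrict_iff' measurableSet_Ioi).2 (ae_of_all _ hdom))
  refine ⟨hint, ?_⟩
  -- the two terms of `E(x)`
  have h1 : (θ x - x) / (x * Real.log x) ≤ 0.2 / Real.log x ^ 3 := by
    have hθ := (abs_lt.1 (hD x hx)).2
    rw [div_le_div_iff₀ (by positivity) (by positivity)]
    have : (θ x - x) * Real.log x ^ 3 ≤ (0.2 * x / Real.log x ^ 2) * Real.log x ^ 3 :=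
      mul_le_mul_of_nonneg_right hθ.le (by positivity)
    calc (θ x - x) * Real.log x ^ 3 ≤ (0.2 * x / Real.log x ^ 2) * Real.log x ^ 3 := this
      _ = 0.2 * (x * Real.log x) := by field_simp
  have h2 : -(∫ t in Ioi x, (θ t - t) * mertensWeight t) ≤
      0.2 * (1 / (3 * Real.log x ^ 3) + 1 / (2 * Real.log x ^ 2)) := by
    have hn := norm_integral_le_of_norm_le (hgi.const_mul 0.2)
      ((ae_restrict_iff' measurableSet_Ioi).2 (ae_of_all _ hdom))
    rw [integral_const_mul, hgv, Real.norm_eq_abs] at hn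
    linarith [neg_abs_le (∫ t in Ioi x, (θ t - t) * mertensWeight t)]
  unfold mertensRemainder
  linarith

/-! ### The analytic inequality at primes `q ≥ 3594641` for `t = 7` -/

/-- `log x ≥ 15` for `x ≥ 3594641` (`e¹⁵ < 3269018`). [folklore] -/
private theorem fifteen_le_log {x : ℝ} (hx : 3594641 ≤ x) : 15 ≤ Real.log x := by
  rw [Real.le_log_iff_exp_le (by linarith)]
  have h1 : Real.exp 15 = Real.exp 1 ^ 15 := by rw [← Real.exp_nat_mul]; norm_num
  rw [h1]
  have h2 := Real.exp_one_lt_d9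
  calc Real.exp 1 ^ 15 ≤ (2.7182818286 : ℝ) ^ 15 := pow_le_pow_left₀ (Real.exp_pos 1).le h2.le 15
    _ ≤ x := by norm_num; linarith

/-- **The analytic half for `t = 7` from Dusart's bound**: for every prime `q ≥ 3594641`,
`∏_{p ≤ q} (1 + 1/p + ⋯ + 1/p⁶) < e^γ log θ(q)`. [cite: SolePlanat2012, §3 (Prop. 2 and its lemmas); Dusart2010, Thm. 5.2] -/
theorem prod_dedekindFactor_seven_lt_of_dusart (hD : Dusart2010_theta_thm_5_2) {q : ℕ}
    (hq : 3594641 ≤ q) :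
    ∏ p ∈ Nat.primesLE q, dedekindFactor 7 p < Real.exp eulerMascheroniConstant * Real.log (θ (q : ℝ)) := by
  have hqR : (3594641 : ℝ) ≤ q := by exact_mod_cast hq
  have hq0 : (0 : ℝ) < q := by linarith
  have hq1 : (1 : ℝ) < q := by linarith
  set L := Real.log (q : ℝ) with hL
  have hL15 : 15 ≤ L := fifteen_le_log hqR
  have hL0 : 0 < L := by linarith
  have heγ : 0 < Real.exp eulerMascheroniConstant := Real.exp_pos _
  -- the Euler factor and the Mertens factor
  rw [prod_dedekindFactor_eq]
  have hA := prod_euler_seven_le (show 23 ≤ q by omega)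
  have hA0 : 0 ≤ ∏ p ∈ Nat.primesLE q, (1 - ((p : ℝ)⁻¹) ^ 7) :=
    Finset.prod_nonneg fun p hp => (euler_factor_mem (Nat.prime_of_mem_primesLE hp).two_le).1
  obtain ⟨hint, hE⟩ := mertensRemainder_le_of_dusart hD hqR
  have hB := prod_one_sub_inv_inv_le (show (2 : ℝ) ≤ q by linarith) hint
  rw [Nat.floor_natCast] at hB
  -- `E(q) ≤ 0.000524`, `e^{E} ≤ 1.000525`
  have hE' : mertensRemainder (q : ℝ) ≤ 0.000524 := by
    have h3 : 0.2 / L ^ 3 ≤ 0.2 / 15 ^ 3 := by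
      apply div_le_div_of_nonneg_left (by norm_num) (by positivity)
      exact pow_le_pow_left₀ (by norm_num) hL15 3
    have h4 : 1 / (3 * L ^ 3) ≤ 1 / (3 * 15 ^ 3) := by
      apply div_le_div_of_nonneg_left (by norm_num) (by positivity)
      exact mul_le_mul_of_nonneg_left (pow_le_pow_left₀ (by norm_num) hL15 3) (by norm_num)
    have h5 : 1 / (2 * L ^ 2) ≤ 1 / (2 * 15 ^ 2) := by
      apply div_le_div_of_nonneg_left (by norm_num) (by positivity)
      exact mul_le_mul_of_nonneg_left (pow_le_pow_left₀ (by norm_num) hL15 2) (by norm_num)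
    have : (0.2 : ℝ) / 15 ^ 3 + 0.2 * (1 / (3 * 15 ^ 3) + 1 / (2 * 15 ^ 2)) ≤ 0.000524 := by norm_num
    linarith
  have hexpE : Real.exp (mertensRemainder (q : ℝ)) ≤ 1.000525 := by
    refine (Real.exp_le_exp.2 hE').trans ?_
    have h := Real.abs_exp_sub_one_sub_id_le (x := (0.000524 : ℝ)) (by rw [abs_le]; constructor <;> norm_num)
    have := (abs_le.1 h).2
    nlinarith
  -- the right-hand side: `log θ(q) ≥ L − 0.0009`
  have hd : (0.2 : ℝ) / L ^ 2 ≤ 0.0009 := by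
    have : (0.2 : ℝ) / L ^ 2 ≤ 0.2 / 15 ^ 2 := by
      apply div_le_div_of_nonneg_left (by norm_num) (by positivity)
      exact pow_le_pow_left₀ (by norm_num) hL15 2
    have h2 : (0.2 : ℝ) / 15 ^ 2 ≤ 0.00089 := by norm_num
    linarith
  have hθlo : (q : ℝ) * (1 - 0.2 / L ^ 2) ≤ θ (q : ℝ) := by
    have h := (abs_lt.1 (hD q hqR)).1
    have e : (q : ℝ) * (1 - 0.2 / L ^ 2) = q - 0.2 * q / L ^ 2 := by rw [hL]; field_simp
    rw [e]; linarith
  have h1d : (0 : ℝ) < 1 - 0.2 / L ^ 2 := by linarith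
  have hθpos : 0 < θ (q : ℝ) := lt_of_lt_of_le (by positivity) hθlo
  have hlogθ : L - 0.0009 / (1 - 0.0009) ≤ Real.log (θ (q : ℝ)) := by
    have h1 : Real.log ((q : ℝ) * (1 - 0.2 / L ^ 2)) ≤ Real.log (θ (q : ℝ)) :=
      Real.log_le_log (by positivity) hθlo
    rw [Real.log_mul hq0.ne' h1d.ne'] at h1
    -- `log(1 − d) ≥ 1 − 1/(1 − d) = −d/(1 − d)`
    have h2 : 1 - (1 - 0.2 / L ^ 2)⁻¹ ≤ Real.log (1 - 0.2 / L ^ 2) :=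
      Real.one_sub_inv_le_log_of_pos h1d
    have h3 : (1 - 0.2 / L ^ 2)⁻¹ ≤ (1 - (0.0009 : ℝ))⁻¹ := by
      apply inv_anti₀ (by norm_num); linarith
    have h4 : (0.0009 : ℝ) / (1 - 0.0009) = (1 - (0.0009 : ℝ))⁻¹ - 1 := by norm_num
    rw [← hL] at h1
    linarith
  -- assemble: `A · B ≤ 0.99173 · e^γ · L · 1.000525 < e^γ (L − 0.0009/(1 − 0.0009)) ≤ e^γ log θ(q)`
  have hB0 : 0 ≤ Real.exp eulerMascheroniConstant * L * Real.exp (mertensRemainder (q : ℝ)) := by positivity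
  have hAB : (∏ p ∈ Nat.primesLE q, (1 - ((p : ℝ)⁻¹) ^ 7)) * ∏ p ∈ Nat.primesLE q, (1 - (p : ℝ)⁻¹)⁻¹ ≤
      0.99173 * (Real.exp eulerMascheroniConstant * L * 1.000525) := by
    calc (∏ p ∈ Nat.primesLE q, (1 - ((p : ℝ)⁻¹) ^ 7)) * ∏ p ∈ Nat.primesLE q, (1 - (p : ℝ)⁻¹)⁻¹
        ≤ 0.99173 * (Real.exp eulerMascheroniConstant * L * Real.exp (mertensRemainder (q : ℝ))) :=
          mul_le_mul hA hB (Finset.prod_nonneg fun p hp => by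
            have h2 : (2 : ℝ) ≤ p := by exact_mod_cast (Nat.prime_of_mem_primesLE hp).two_le
            have : (p : ℝ)⁻¹ ≤ 1 / 2 := by
              rw [inv_eq_one_div]; exact one_div_le_one_div_of_le (by norm_num) h2
            have : 0 < 1 - (p : ℝ)⁻¹ := by linarith
            positivity) (by norm_num)
      _ ≤ 0.99173 * (Real.exp eulerMascheroniConstant * L * 1.000525) := by
          gcongr
  have hfinal : 0.99173 * (Real.exp eulerMascheroniConstant * L * 1.000525) <
      Real.exp eulerMascheroniConstant * (L - 0.0009 / (1 - 0.0009)) := by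
    have hpos : 0 < Real.exp eulerMascheroniConstant * (0.007 * L - 0.001) := by
      apply mul_pos heγ; linarith
    nlinarith
  calc (∏ p ∈ Nat.primesLE q, (1 - ((p : ℝ)⁻¹) ^ 7)) * ∏ p ∈ Nat.primesLE q, (1 - (p : ℝ)⁻¹)⁻¹
      ≤ 0.99173 * (Real.exp eulerMascheroniConstant * L * 1.000525) := hAB
    _ < Real.exp eulerMascheroniConstant * (L - 0.0009 / (1 - 0.0009)) := hfinal
    _ ≤ Real.exp eulerMascheroniConstant * Real.log (θ (q : ℝ)) :=
        mul_le_mul_of_nonneg_left hlogθ heγ.le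

/-! ### The verified range `5040 < n < 3594641#` -/

/-- `3594641` (Dusart's threshold) is prime. [folklore] -/
private theorem prime_3594641 : Nat.Prime 3594641 := by norm_num

/-- Under Dusart's bound, `3594641# ≤ 10^1958000` (`log 3594641# = θ(3594641) < 1.001 · 3594641`).
[cite: Dusart2010, Thm. 5.2] -/
private theorem primorial_le_ten_pow (hD : Dusart2010_theta_thm_5_2) :
    primorial 3594641 ≤ 10 ^ 1958000 := by
  have hθ := (abs_lt.1 (hD 3594641 le_rfl)).2
  have hL := fifteen_le_log (le_refl (3594641 : ℝ))
  have hθ' : θ (3594641 : ℝ) ≤ 3916000 := by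
    have h1 : (0.2 : ℝ) * 3594641 / Real.log 3594641 ^ 2 ≤ 0.2 * 3594641 / 15 ^ 2 := by
      apply div_le_div_of_nonneg_left (by norm_num) (by positivity)
      exact pow_le_pow_left₀ (by norm_num) hL 2
    have h2 : (0.2 : ℝ) * 3594641 / 15 ^ 2 ≤ 4000 := by norm_num
    linarith
  have hlog10 : (2 : ℝ) ≤ Real.log 10 := by
    rw [Real.le_log_iff_exp_le (by norm_num)]
    have h1 : Real.exp 2 = Real.exp 1 ^ 2 := by rw [← Real.exp_nat_mul]; norm_num
    rw [h1]
    have h2 := Real.exp_one_lt_d9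
    nlinarith [Real.exp_pos 1]
  have hprim : ((primorial 3594641 : ℕ) : ℝ) = Real.exp (θ (3594641 : ℝ)) := by
    have h := Chebyshev.theta_eq_log_primorial (x := ((3594641 : ℕ) : ℝ))
    rw [Nat.floor_natCast] at h
    push_cast at h
    rw [h, Real.exp_log]
    exact_mod_cast primorial_pos _
  have key : ((primorial 3594641 : ℕ) : ℝ) ≤ (10 : ℝ) ^ (1958000 : ℕ) := by
    rw [hprim, ← Real.rpow_natCast, Real.rpow_def_of_pos (by norm_num : (0 : ℝ) < 10),
      Real.exp_le_exp]
    push_cast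
    nlinarith
  have key' : ((primorial 3594641 : ℕ) : ℝ) ≤ ((10 ^ 1958000 : ℕ) : ℝ) := by
    rw [Nat.cast_pow, Nat.cast_ofNat]
    exact key
  exact Nat.cast_le.1 key'

/-- Robin's inequality on `5040 < n < 3594641#`, from the tree's certified range `≤ 10^1958000`.
[cite: Axler2017, §2] -/
private theorem robin_range (hD : Dusart2010_theta_thm_5_2) :
    ∀ n : ℕ, 5040 < n → n < primorial 3594641 → robinInequality n :=
  fun n hn hlt => robinInequality_le_ten_pow_1958000 n hn (hlt.le.trans (primorial_le_ten_pow hD))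

/-! ### The theorems -/

/-- **Solé–Planat 2012, main theorem, from Dusart's `θ` bound (PROVED)**: every `7`-free integer
`n > 5040` satisfies Robin's inequality `σ(n) < e^γ n log log n` (printed: "If `N` is `7`-free then
`σ(N) < e^γ N log log N`", the range of Robin's criterion being understood).
[cite: SolePlanat2012, §3 (main theorem); Broughan2017Arithmetic, §8.4 (pp. 211–214)] -/
theorem robinInequality_of_tFree_seven_of_dusart (hD : Dusart2010_theta_thm_5_2) {n : ℕ}
    (hn : 5040 < n) (htf : TFree 7 n) : robinInequality n :=
  robinInequality_of_tFree_of_primorial_bound (t := 7) (by norm_num) prime_3594641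
    (fun _ _ hq => prod_dedekindFactor_seven_lt_of_dusart hD hq) (robin_range hD) n hn htf

/-- **CLMS 2007, Thm. 1.5, from Dusart's `θ` bound (PROVED)**: every `5`-free integer `n > 5040`
satisfies Robin's inequality — the tree's named fact `CLMS2007_thm1_5` follows from
`Dusart2010_theta_thm_5_2` (a `5`-free integer is `7`-free).
[cite: CLMS2007, Thm. 1.5; Broughan2017Arithmetic, §8.3 (pp. 208–211)] -/
theorem CLMS2007_thm1_5_of_dusart (hD : Dusart2010_theta_thm_5_2) : CLMS2007_thm1_5 :=
  fun _ hn htf => robinInequality_of_tFree_seven_of_dusart hD hn (TFree.mono (by norm_num) htf)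

/-- RH-FREE consequence: a counterexample `n > 5040` to Robin's inequality is divisible by `p⁷` for
some prime `p` (Broughan vol. 1, §1.3: "any counterexample must be divisible by … the seventh power";
from Dusart's bound). [cite: SolePlanat2012, §1 (Cor.); Broughan2017Arithmetic, §1.3 p. 11] -/
theorem exists_prime_pow_seven_dvd_of_not_robinInequality (hD : Dusart2010_theta_thm_5_2) {n : ℕ}
    (hn : 5040 < n) (hfail : ¬ robinInequality n) : ∃ p : ℕ, p.Prime ∧ p ^ 7 ∣ n := by
  by_contra hcon
  exact hfail (robinInequality_of_tFree_seven_of_dusart hD hn fun p hp hdvd => hcon ⟨p, hp, hdvd⟩)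

/-- **RH `⟺` Robin's inequality for the integers divisible by a seventh prime power** (Solé–Planat
2012 / Broughan §8.4 criterion; kernel-grade form from `robin_iff` and Dusart's bound; the range
`n ≤ 5040` by the tree's `robinInequality_of_prime_pow_five_dvd`).
[cite: SolePlanat2012, §1; Broughan2017Arithmetic, §8.4] -/
theorem riemannHypothesis_iff_robin_of_prime_pow_seven_dvd_of_dusart_of (hR : robin_iff)
    (hD : Dusart2010_theta_thm_5_2) :
    RiemannHypothesis ↔ ∀ n : ℕ, 0 < n → (∃ p : ℕ, p.Prime ∧ p ^ 7 ∣ n) → robinInequality n := by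
  rw [robin_iff_iff.1 hR]
  refine ⟨fun h n hn0 ⟨p, hp, hdvd⟩ => ?_, fun h n hn => ?_⟩
  · by_cases hbig : 5040 < n
    · exact h n hbig
    · exact robinInequality_of_prime_pow_five_dvd hp ((pow_dvd_pow p (by norm_num : 5 ≤ 7)).trans hdvd)
        hn0 (by omega)
  · by_cases htf : TFree 7 n
    · exact robinInequality_of_tFree_seven_of_dusart hD hn htf
    · exact h n (by omega) (not_tFree_iff.1 htf)

/-- **RH `⟺` Robin's inequality for the integers divisible by a seventh prime power**, from Dusart's
bound, via `robin_iff_holds` (computational closure). [cite: SolePlanat2012, §1; Broughan2017Arithmetic, §8.4] -/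
theorem riemannHypothesis_iff_robin_of_prime_pow_seven_dvd_of_dusart (hD : Dusart2010_theta_thm_5_2) :
    RiemannHypothesis ↔ ∀ n : ℕ, 0 < n → (∃ p : ℕ, p.Prime ∧ p ^ 7 ∣ n) → robinInequality n :=
  riemannHypothesis_iff_robin_of_prime_pow_seven_dvd_of_dusart_of robin_iff_holds hD

/-- **CLMS 2007, Thm. 1.6, from Dusart's bound**: RH `⟺` Robin's inequality for the integers `n ≥ 1`
divisible by the fifth power of some prime (via `robin_iff_holds`, computational closure).
[cite: CLMS2007, Thm. 1.6; Broughan2017Arithmetic, §8.3] -/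
theorem riemannHypothesis_iff_robin_of_prime_pow_five_dvd_of_dusart (hD : Dusart2010_theta_thm_5_2) :
    RiemannHypothesis ↔ ∀ n : ℕ, 0 < n → (∃ p : ℕ, p.Prime ∧ p ^ 5 ∣ n) → robinInequality n :=
  riemannHypothesis_iff_robin_of_prime_pow_five_dvd (CLMS2007_thm1_5_of_dusart hD)

end RobinTFreeDusart

end Literature.NumberTheory.LFunctions

end
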